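/-
Copyright: the b2b-balaban T⁴-continuum CRUX team, row NE7b OWNER lineage `t4-ne7b-p1` (gen 125). Project licence.
-/
import Summits.QuantumFields.BalabanUV.T4Continuum.Spine.NE7b.SupZdPerturbedCoarseForm

/-!
# DATA THAT NEARLY AGREE ON A REGION GIVE BOUNDED `ℤ^d` SOLUTIONS OF `H_V + K` THAT AGREE THERE EXPONENTIALLY: for potentials
# `V₁, V₂ : ℤ^d → [−λ, Λ]` coinciding on the blocks of a coarse set `A`, ONE kernel `|K(p,q)| ≤ εe^{−γ|p−q|₁}` of the class, bounded
# sources `|f₁|, |f₂| ≤ M` with `|f₁ − f₂| ≤ η` on the blocks of `A`, the bounded solutions of `(H_{V_i} + K)u_i = f_i` satisfy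
# `|u₁(p) − u₂(p)| ≤ C_∞η + C_∞(2 + 2(|λ| + Λ)C_∞)M·e^{−(μ∕2)D}` for every `D ≤ dist₁(blk n p, ℤ^d ∖ A)`, `C_∞ = 2C_PK_{δ₀−μ}K_{μ∕2}` — BLOCK
# SUPERPOSITION for the perturbed operator: the block pieces of a bounded source have (216)'s decaying solutions, the series of them
# converges absolutely, the finite stencil AND the kernel (Fubini on `ℤ^d × ℤ^d`) pass through it, so it IS the bounded solution ((216)'s
# uniqueness) and is small far from the support.  The `H + K` twin of (196), the `ℤ^d` estimate behind the torus → `ℤ^d` SEAM of the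
# perturbed next-scale Hessian (row NE7b, node U5c; (189)∕(216) BY NAME; [folklore])

Cell `pub-balaban`, sub-cell `t4`, spine estimate NE7b (`T4WeightBudget.RelWeightBound`; the cell's OWN estimate — NOT PRINTED in
[Bałaban 1983–89], NOT PROVED).  Crux-route work under `Spine/NE7b/` by the row OWNER (`t4-ne7b-p1` gen 125, file (237)) under FREEZE
(0)'s crux-prover clause; NOTHING of Bałaban's is named as a Lean object, valued or asserted; no `T4Continuum/Support` leaf typed; no `def`,
no notation (the operator `(H_V + K)u` DISPLAYED; the superposition is an `∃ W`); zero `sorry`.  Imports (BY NAME): the OWNER's (234)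
`…SupZdPerturbedCoarseForm` (import closure: (216) `zd_perturbed_profile` — the perturbed Green's operator on `ℓ^∞(ℤ^d)` with uniqueness
and the profile lemma —, (222) `K_pos`, (189) `summable_exp_l1`, `tsum_exp_l1_le`, `summable_kernel_row`, (48) `abs_apply_le_norm`),
Mathlib's `memℓp_infty`, `summable_prod_of_nonneg`, `Summable.tsum_comm`, `Summable.tsum_finsetSum`, `Summable.tsum_add`, `tsum_eq_single`,
`norm_tsum_le_tsum_norm`.

WHY (located).  The torus side of the `H + K` identification ((236) is its `ℤ^d` side) compares the lifted torus column `ψ^{K_k}∘σ` with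
`Ψ^K`: moving the window's kernel difference into the source, both solve `(H_V + K^W)u = f` on `ℤ^d` with the SAME truncated kernel `K^W`,
with data that agree on the deep blocks up to an exponentially small defect `η` and differ arbitrarily beyond the seam.  (196) turned «data
agree on the blocks of `A`» into «solutions agree up to `e^{−δ·dist(·, Aᶜ)}`» for `H_V`; this file does it for `H_V + K`, with the defect
`η`: the difference solves `(H_{V₁} + K)w = g`, `g = g_A + g_far` (`|g_A| ≤ η` on the blocks of `A`, `g_far = 0` there, `|g_far| ≤ M_g`); the
perturbed block superposition (§1) solves both pieces — `|W_A| ≤ C_∞η` (global bound) and `|W_far(p)| ≤ C_∞M_ge^{−(μ∕2)D}` (decay) — and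
uniqueness of bounded solutions identifies `W_A + W_far` with `w`.  The global bound `‖G_K‖_{∞→∞} ≤ C_∞` is §1 with `A = ∅`, so no
constant of (213) needs matching.

WHAT IS PROVED ([folklore]): §1 **`zd_perturbed_block_superposition`** (`∃ C₀ C_P δ₀ > 0` ((216)'s): for ALL `n, V`, rates∕sizes under
(216)'s two smallness conditions, kernels of the class, `|g| ≤ M_g` with `g = 0` on the blocks of `A`: `∃ W`, `(H_V + K)W = g`, `|W| ≤ C_∞M_g`,
`|W(p)| ≤ C_∞M_ge^{−(μ∕2)D}` whenever `D ≤ |blk n p − c|₁` for all `c ∉ A`); §2 `perturbed_difference_equation'` (two sources); §3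
**`zd_perturbed_data_agreement`** (THE END, as displayed above); §4 toy.

HONEST (what this is NOT).  A linear comparison lemma for ONE kernel on both sides (the window's kernel defect goes into the sources);
the seam estimate itself and the torus limit are the sequel; `d ≥ 3`; scalar skeleton ((A3), NC-NE7b-α UNRULED); nothing of the covariant
propagators of [B4]–[B6]; nothing of Bałaban's asserted.  BY-NAME EFFECT ON THE WALL: NONE.  NE7b NOT PRINTED ∕ NOT PROVED; spine PROVED
0∕9; rung (B)+1 — the programme's measures remain FINITE-torus statements; NOT the mass gap, NOT Clay.  HONEST DEPENDENCY: continuum YM on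
T⁴ ⇐ BetaPertH ∧ nine spine estimates (0∕9 proved); BetaPertH ⇐ (D1) ∧ (D4) ∧ CAP+tail; G-an2-4 gates asym, D1 and NE2∕3∕4.
-/

set_option autoImplicit false

noncomputable section

namespace Summit.QuantumFields.BalabanUV.T4Continuum.NE7b.SupZdPerturbedDataAgreement

open Real Filter Topology
open scoped ENNReal
open Literature.MathematicalPhysics.QuantumFieldTheory.Balaban1983to89
open B6QGQLower276 (X e blk B mem_B sum_B_const)
open OneShotChartSupOperator (abs_apply_le_norm)
open SupZdExponentialSums (summable_exp_l1 tsum_exp_l1_le summable_kernel_row)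
open SupZdPerturbedColumn (K_pos)
open SupZdPerturbedCoarseEntries (zd_perturbed_profile)

variable {d : ℕ}

/-! ## §1. Perturbed block superposition on `ℤ^d` -/

/-- **PERTURBED BLOCK SUPERPOSITION**: `∃ C₀ C_P δ₀ > 0` ((216)'s) such that for ALL `n`, `V : ℤ^d → [−λ, Λ]`, rates `0 < μ < min(δ₀, γ)`,
sizes `ε ≥ 0` under (216)'s two smallness conditions, kernels `|K(p,q)| ≤ εe^{−γ|p−q|₁}`, and every bounded source `|g| ≤ M_g` vanishing on
the blocks of a coarse set `A`: the series `W = Σ′_cw_c` of the decaying solutions of the block pieces `g𝟙_{B n c}` ((216): `G_K` and the profile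
lemma) converges absolutely at every point, SOLVES `(H_V + K)W = g` (the stencil by finite linearity, the kernel by Fubini on `ℤ^d × ℤ^d`),
`|W| ≤ C_∞M_g` and `|W(p)| ≤ C_∞M_ge^{−(μ∕2)D}` whenever `D ≤ |blk n p − c|₁` for every `c ∉ A`, `C_∞ = 2C_PK_{δ₀−μ}K_{μ∕2}`. [folklore] -/
theorem zd_perturbed_block_superposition (hd : 3 ≤ d) (a : ℝ) (ha : 0 < a) {lam Lam : ℝ} (hlam : lam < min 2 a) (hLam : 0 ≤ Lam) :
    ∃ C₀ CP δ₀ : ℝ, 0 < C₀ ∧ 0 < CP ∧ 0 < δ₀ ∧ ∀ (n : ℕ) (V : X d → ℝ), (∀ p, -lam ≤ V p) → (∀ p, V p ≤ Lam) →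
      ∀ (ε γ μ : ℝ), 0 ≤ ε → 0 < μ → μ < δ₀ → μ < γ →
      ε * (2 * (1 - exp (-γ))⁻¹) ^ d * C₀ ≤ 1 / 2 →
      (CP * (2 * (1 - exp (-(δ₀ - μ)))⁻¹) ^ d) * (ε * exp (μ * d) * (2 * (1 - exp (-(γ - μ)))⁻¹) ^ d) ≤ 1 / 2 →
      ∀ (K : X d → X d → ℝ), (∀ p q, |K p q| ≤ ε * exp (-(γ * ∑ i, (((p i - q i).natAbs : ℕ) : ℝ)))) →
      -- (U) bounded solutions are unique
      (∀ (f : X d → ℝ) (Mf : ℝ), (∀ p, |f p| ≤ Mf) → ∀ (u v : X d → ℝ) (Bu Bv : ℝ), (∀ p, |u p| ≤ Bu) → (∀ p, |v p| ≤ Bv) →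
        (∀ p, ((n : ℝ) + 1) ^ 2 * ∑ μ', (2 * u p - u (p + e μ') - u (p - e μ'))
          + a / ((n : ℝ) + 1) ^ d * ∑ q ∈ B n (blk n p), u q + V p * u p + ∑' q : X d, K p q * u q = f p) →
        (∀ p, ((n : ℝ) + 1) ^ 2 * ∑ μ', (2 * v p - v (p + e μ') - v (p - e μ'))
          + a / ((n : ℝ) + 1) ^ d * ∑ q ∈ B n (blk n p), v q + V p * v p + ∑' q : X d, K p q * v q = f p) →
        ∀ p, u p = v p) ∧
      -- (S) block superposition
      ∀ (g : X d → ℝ) (Mg : ℝ), (∀ p, |g p| ≤ Mg) → ∀ (A : Set (X d)), (∀ p, blk n p ∈ A → g p = 0) →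
      ∃ W : X d → ℝ,
        (∀ p, ((n : ℝ) + 1) ^ 2 * ∑ μ', (2 * W p - W (p + e μ') - W (p - e μ'))
          + a / ((n : ℝ) + 1) ^ d * ∑ q ∈ B n (blk n p), W q + V p * W p + ∑' q : X d, K p q * W q = g p) ∧
        (∀ p, |W p| ≤ 2 * (CP * (2 * (1 - exp (-(δ₀ - μ)))⁻¹) ^ d) * (2 * (1 - exp (-(μ / 2)))⁻¹) ^ d * Mg) ∧
        (∀ (p : X d) (D : ℝ), (∀ c, c ∉ A → D ≤ ∑ i, (((blk n p i - c i).natAbs : ℕ) : ℝ)) →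
          |W p| ≤ 2 * (CP * (2 * (1 - exp (-(δ₀ - μ)))⁻¹) ^ d) * (2 * (1 - exp (-(μ / 2)))⁻¹) ^ d * Mg * exp (-(μ / 2 * D))) := by
  classical
  obtain ⟨C₀, CP, δ₀, hC₀, hCP, hδ₀, H216⟩ := zd_perturbed_profile (d := d) hd a ha hlam hLam
  refine ⟨C₀, CP, δ₀, hC₀, hCP, hδ₀, ?_⟩
  intro n V hV hV' ε γ μ hε hμ hμδ hμγ hs1 hs2 K hK
  obtain ⟨⟨GK, hGKeq, hGKuniq⟩, hP⟩ := H216 n V hV hV' ε γ μ hε hμ hμδ hμγ hs1 hs2 K hK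
  refine ⟨fun f Mf hf u v Bu Bv huB hvB hu hv p => ?_, fun g Mg hg A hgA => ?_⟩
  · -- (U): both are `G_Kf`
    have hmem : Memℓp f ∞ := memℓp_infty ⟨Mf, by
      rintro _ ⟨q, rfl⟩
      show ‖f q‖ ≤ Mf
      rw [Real.norm_eq_abs]; exact hf q⟩
    obtain ⟨fl, hfl⟩ : ∃ fl : lp (fun _ : X d => ℝ) ∞, ∀ q, fl q = f q := ⟨⟨f, hmem⟩, fun _ => rfl⟩
    rw [hGKuniq fl u Bu huB (fun q => by rw [hfl]; exact hu q) p, hGKuniq fl v Bv hvB (fun q => by rw [hfl]; exact hv q) p]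
  have hγ : 0 < γ := hμ.trans hμγ
  have hμ2 : 0 < μ / 2 := by linarith
  have hKh : 0 < (2 * (1 - exp (-(μ / 2)))⁻¹) ^ d := K_pos (d := d) hμ2
  obtain ⟨CPK, hCPK⟩ : ∃ CPK : ℝ, CPK = CP * (2 * (1 - exp (-(δ₀ - μ)))⁻¹) ^ d := ⟨_, rfl⟩
  obtain ⟨Kh, hKhd⟩ : ∃ Kh : ℝ, Kh = (2 * (1 - exp (-(μ / 2)))⁻¹) ^ d := ⟨_, rfl⟩
  have hCPK0 : 0 < CPK := by rw [hCPK]; exact mul_pos hCP (K_pos (d := d) (sub_pos.2 hμδ))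
  have hKh0 : 0 < Kh := by rw [hKhd]; exact hKh
  rw [← hCPK, ← hKhd]
  rw [← hCPK] at hP
  have hMg : 0 ≤ Mg := (abs_nonneg _).trans (hg 0)
  -- the decaying solutions of the block pieces ((216)), vanishing for the pieces over `A`
  have hpiece : ∀ c : X d, ∃ w : X d → ℝ,
      (∀ p, ((n : ℝ) + 1) ^ 2 * ∑ μ', (2 * w p - w (p + e μ') - w (p - e μ'))
        + a / ((n : ℝ) + 1) ^ d * ∑ q ∈ B n (blk n p), w q + V p * w p + ∑' q : X d, K p q * w q
          = if blk n p = c then g p else 0) ∧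
      (∀ p, |w p| ≤ 2 * CPK * Mg * exp (-(μ * ∑ i, (((blk n p i - c i).natAbs : ℕ) : ℝ)))) ∧
      (c ∈ A → ∀ p, w p = 0) := by
    intro c
    have hmem : Memℓp (fun p : X d => if blk n p = c then g p else 0) ∞ := memℓp_infty ⟨Mg, by
      rintro _ ⟨q, rfl⟩
      show ‖(if blk n q = c then g q else 0)‖ ≤ Mg
      rw [Real.norm_eq_abs]
      split_ifs
      · exact hg q
      · rw [abs_zero]; exact hMg⟩
    obtain ⟨fl, hfl⟩ : ∃ fl : lp (fun _ : X d => ℝ) ∞, ∀ q, fl q = if blk n q = c then g q else 0 := ⟨⟨_, hmem⟩, fun _ => rfl⟩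
    have hprof : ∀ q, |(if blk n q = c then g q else 0)| ≤ Mg * exp (-(μ * ∑ i, (((blk n q i - c i).natAbs : ℕ) : ℝ))) := by
      intro q
      split_ifs with h
      · rw [h]
        simp only [sub_self, Int.natAbs_zero, Nat.cast_zero, Finset.sum_const_zero, mul_zero, neg_zero, exp_zero, mul_one]
        exact hg q
      · rw [abs_zero]; positivity
    have heq : ∀ p, ((n : ℝ) + 1) ^ 2 * ∑ μ', (2 * GK fl p - GK fl (p + e μ') - GK fl (p - e μ'))
        + a / ((n : ℝ) + 1) ^ d * ∑ q ∈ B n (blk n p), GK fl q + V p * GK fl p + ∑' q : X d, K p q * GK fl q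
          = if blk n p = c then g p else 0 := fun p => by rw [← hfl]; exact hGKeq fl p
    refine ⟨fun p => GK fl p, heq, fun p => ?_, fun hc p => ?_⟩
    · have h := hP c Mg (fun q => if blk n q = c then g q else 0) hprof (fun p => GK fl p) ‖GK fl‖
        (fun p => abs_apply_le_norm (GK fl) p) heq p
      calc |GK fl p| ≤ 2 * CPK * Mg * exp (-(μ * ∑ i, (((blk n p i - c i).natAbs : ℕ) : ℝ))) := h
        _ = _ := rfl
    · -- the piece over `c ∈ A` vanishes: the zero function solves its equation
      have h0 : ∀ q, ((n : ℝ) + 1) ^ 2 * ∑ μ' : Fin d, (2 * (0 : ℝ) - 0 - 0)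
          + a / ((n : ℝ) + 1) ^ d * ∑ _q ∈ B n (blk n q), (0 : ℝ) + V q * 0 + ∑' q' : X d, K q q' * 0 = fl q := by
        intro q
        simp only [mul_zero, sub_self, Finset.sum_const_zero, tsum_zero, add_zero]
        rw [hfl]
        split_ifs with h
        · exact (hgA q (h ▸ hc)).symm
        · rfl
      exact (hGKuniq fl (fun _ => 0) 0 (fun _ => by rw [abs_zero]) h0 p).symm
  choose w hw hwle hwA using hpiece
  -- absolute convergence in `c` at every point
  have hs : ∀ p, Summable fun c : X d => w c p := fun p =>
    Summable.of_norm_bounded ((summable_exp_l1 hμ (blk n p)).mul_left (2 * CPK * Mg)) fun c => by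
      rw [Real.norm_eq_abs]; exact hwle c p
  have hsb : ∀ p, ∀ c, |w c p| ≤ 2 * CPK * Mg := fun p c =>
    (hwle c p).trans (mul_le_of_le_one_right (by positivity) (exp_le_one_iff.2 (by rw [neg_nonpos]; positivity)))
  -- the decay away from the support
  have hfar : ∀ (p : X d) (D : ℝ), (∀ c, c ∉ A → D ≤ ∑ i, (((blk n p i - c i).natAbs : ℕ) : ℝ)) →
      |∑' c : X d, w c p| ≤ 2 * CPK * Kh * Mg * exp (-(μ / 2 * D)) := by
    intro p D hD
    have hpt : ∀ c : X d, |w c p| ≤ 2 * CPK * Mg * exp (-(μ / 2 * D)) * exp (-(μ / 2 * ∑ i, (((blk n p i - c i).natAbs : ℕ) : ℝ))) := by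
      intro c
      by_cases hc : c ∈ A
      · rw [hwA c hc p, abs_zero]; positivity
      · refine (hwle c p).trans ?_
        rw [mul_assoc (2 * CPK * Mg), ← exp_add]
        refine mul_le_mul_of_nonneg_left (exp_le_exp.2 ?_) (by positivity)
        have := hD c hc
        nlinarith
    have hsum2 : Summable fun c : X d => 2 * CPK * Mg * exp (-(μ / 2 * D))
        * exp (-(μ / 2 * ∑ i, (((blk n p i - c i).natAbs : ℕ) : ℝ))) := (summable_exp_l1 hμ2 (blk n p)).mul_left _
    have h1 : |∑' c : X d, w c p| ≤ ∑' c : X d, |w c p| := by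
      have := norm_tsum_le_tsum_norm (hs p).norm
      simpa only [Real.norm_eq_abs] using this
    have h2 : ∑' c : X d, |w c p| ≤ ∑' c : X d, 2 * CPK * Mg * exp (-(μ / 2 * D))
        * exp (-(μ / 2 * ∑ i, (((blk n p i - c i).natAbs : ℕ) : ℝ))) := (hs p).abs.tsum_le_tsum hpt hsum2
    have h3 : ∑' c : X d, 2 * CPK * Mg * exp (-(μ / 2 * D)) * exp (-(μ / 2 * ∑ i, (((blk n p i - c i).natAbs : ℕ) : ℝ)))
        = 2 * CPK * Mg * exp (-(μ / 2 * D)) * ∑' c : X d, exp (-(μ / 2 * ∑ i, (((blk n p i - c i).natAbs : ℕ) : ℝ))) :=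
      (summable_exp_l1 hμ2 (blk n p)).tsum_mul_left _
    have h4 := tsum_exp_l1_le hμ2 (blk n p); rw [← hKhd] at h4
    have h5 : 2 * CPK * Mg * exp (-(μ / 2 * D)) * ∑' c : X d, exp (-(μ / 2 * ∑ i, (((blk n p i - c i).natAbs : ℕ) : ℝ)))
        ≤ 2 * CPK * Mg * exp (-(μ / 2 * D)) * Kh := mul_le_mul_of_nonneg_left h4 (by positivity)
    calc |∑' c : X d, w c p| ≤ 2 * CPK * Mg * exp (-(μ / 2 * D)) * Kh := h1.trans (h2.trans (h3.le.trans h5))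
      _ = 2 * CPK * Kh * Mg * exp (-(μ / 2 * D)) := by ring
  -- the kernel passes through the series: Fubini on `ℤ^d × ℤ^d`
  have hker : ∀ p, Summable (fun c : X d => ∑' q : X d, K p q * w c q) ∧
      ∑' q : X d, K p q * ∑' c : X d, w c q = ∑' c : X d, ∑' q : X d, K p q * w c q := by
    intro p
    obtain ⟨G, hG⟩ : ∃ G : X d × X d → ℝ, ∀ x, G x = (ε * exp (-(γ * ∑ i, (((p i - x.1 i).natAbs : ℕ) : ℝ))))
        * ((2 * CPK * Mg) * exp (-(μ * ∑ i, (((blk n x.1 i - x.2 i).natAbs : ℕ) : ℝ)))) := ⟨_, fun _ => rfl⟩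
    have hG0 : 0 ≤ G := fun x => by rw [hG]; positivity
    have hGs : Summable G := by
      refine (summable_prod_of_nonneg hG0).2 ⟨fun q => ?_, ?_⟩
      · exact ((summable_exp_l1 hμ (blk n q)).mul_left (ε * exp (-(γ * ∑ i, (((p i - q i).natAbs : ℕ) : ℝ))) * (2 * CPK * Mg))).congr
          fun c => by rw [hG]; ring
      · have e : ∀ q : X d, ∑' c, G (q, c) = ε * exp (-(γ * ∑ i, (((p i - q i).natAbs : ℕ) : ℝ))) * (2 * CPK * Mg)
            * ∑' c : X d, exp (-(μ * ∑ i, (((blk n q i - c i).natAbs : ℕ) : ℝ))) := fun q => by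
          rw [← tsum_mul_left]; exact tsum_congr fun c => by rw [hG]; ring
        refine Summable.of_nonneg_of_le (fun q => tsum_nonneg fun c => hG0 (q, c)) (fun q => ?_)
          ((summable_exp_l1 hγ p).mul_left (ε * (2 * CPK * Mg) * (2 * (1 - exp (-μ))⁻¹) ^ d))
        rw [e q]
        calc ε * exp (-(γ * ∑ i, (((p i - q i).natAbs : ℕ) : ℝ))) * (2 * CPK * Mg)
              * ∑' c : X d, exp (-(μ * ∑ i, (((blk n q i - c i).natAbs : ℕ) : ℝ)))
            ≤ ε * exp (-(γ * ∑ i, (((p i - q i).natAbs : ℕ) : ℝ))) * (2 * CPK * Mg) * (2 * (1 - exp (-μ))⁻¹) ^ d :=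
              mul_le_mul_of_nonneg_left (tsum_exp_l1_le hμ (blk n q)) (by positivity)
          _ = _ := by ring
    obtain ⟨F, hF⟩ : ∃ F : X d → X d → ℝ, ∀ q c, F q c = K p q * w c q := ⟨_, fun _ _ => rfl⟩
    have hFs : Summable (Function.uncurry F) := by
      refine Summable.of_norm_bounded hGs fun x => ?_
      rw [Function.uncurry_apply_pair] at *
      show ‖F x.1 x.2‖ ≤ G x
      rw [hF, hG, Real.norm_eq_abs, abs_mul]
      exact mul_le_mul (hK p x.1) (hwle x.2 x.1) (abs_nonneg _) (by positivity)
    have hrow : Summable fun c : X d => ∑' q : X d, F q c := hFs.prod_symm.prod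
    refine ⟨hrow.congr fun c => tsum_congr fun q => by rw [hF], ?_⟩
    have e1 : ∀ q, K p q * ∑' c : X d, w c q = ∑' c : X d, F q c := fun q => by
      rw [← tsum_mul_left]; exact tsum_congr fun c => by rw [hF]
    rw [tsum_congr e1, ← hFs.tsum_comm]
    exact tsum_congr fun c => tsum_congr fun q => by rw [hF]
  refine ⟨fun p => ∑' c : X d, w c p, fun p => ?_, fun p => ?_, hfar⟩
  · -- the finite stencil and the kernel pass through the absolutely convergent series
    have hpt : ∑' c : X d, (((n : ℝ) + 1) ^ 2 * ∑ μ', (2 * w c p - w c (p + e μ') - w c (p - e μ'))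
        + a / ((n : ℝ) + 1) ^ d * ∑ q ∈ B n (blk n p), w c q + V p * w c p + ∑' q : X d, K p q * w c q) = g p := by
      simp only [hw]
      rw [tsum_eq_single (blk n p) (fun c hc => by rw [if_neg (Ne.symm hc)]), if_pos rfl]
    have hS1 : ∀ μ' : Fin d, Summable fun c : X d => 2 * w c p - w c (p + e μ') - w c (p - e μ') :=
      fun μ' => (((hs p).mul_left 2).sub (hs (p + e μ'))).sub (hs (p - e μ'))
    have hS1s : Summable fun c : X d => ∑ μ', (2 * w c p - w c (p + e μ') - w c (p - e μ')) := summable_sum fun μ' _ => hS1 μ'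
    have hS2 : Summable fun c : X d => ∑ q ∈ B n (blk n p), w c q := summable_sum fun q _ => hs q
    have hS4 := (hker p).1
    have hT1 : ∑' c : X d, ∑ μ', (2 * w c p - w c (p + e μ') - w c (p - e μ'))
        = ∑ μ', (2 * (∑' c : X d, w c p) - (∑' c : X d, w c (p + e μ')) - (∑' c : X d, w c (p - e μ'))) := by
      rw [Summable.tsum_finsetSum fun μ' _ => hS1 μ']
      refine Finset.sum_congr rfl fun μ' _ => ?_
      rw [(((hs p).mul_left 2).sub (hs (p + e μ'))).tsum_sub (hs (p - e μ')), ((hs p).mul_left 2).tsum_sub (hs (p + e μ')),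
        (hs p).tsum_mul_left 2]
    have hT2 : ∑' c : X d, ∑ q ∈ B n (blk n p), w c q = ∑ q ∈ B n (blk n p), ∑' c : X d, w c q :=
      Summable.tsum_finsetSum fun q _ => hs q
    have hmain : ∑' c : X d, (((n : ℝ) + 1) ^ 2 * ∑ μ', (2 * w c p - w c (p + e μ') - w c (p - e μ'))
        + a / ((n : ℝ) + 1) ^ d * ∑ q ∈ B n (blk n p), w c q + V p * w c p + ∑' q : X d, K p q * w c q)
        = ((n : ℝ) + 1) ^ 2 * ∑' c : X d, ∑ μ', (2 * w c p - w c (p + e μ') - w c (p - e μ'))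
          + a / ((n : ℝ) + 1) ^ d * ∑' c : X d, ∑ q ∈ B n (blk n p), w c q + V p * ∑' c : X d, w c p
          + ∑' c : X d, ∑' q : X d, K p q * w c q := by  -- four `tsum_add`s
      rw [Summable.tsum_add (((hS1s.mul_left _).add (hS2.mul_left _)).add ((hs p).mul_left _)) hS4,
        Summable.tsum_add ((hS1s.mul_left _).add (hS2.mul_left _)) ((hs p).mul_left _),
        Summable.tsum_add (hS1s.mul_left _) (hS2.mul_left _), hS1s.tsum_mul_left (((n : ℝ) + 1) ^ 2),
        hS2.tsum_mul_left (a / ((n : ℝ) + 1) ^ d), (hs p).tsum_mul_left (V p)]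
    rw [← hpt, hmain, hT1, hT2, (hker p).2]
  · -- the global bound: `D = 0`
    have h := hfar p 0 (fun c _ => by positivity)
    rw [mul_zero, neg_zero, exp_zero, mul_one] at h
    exact h

/-! ## §2. The difference of two perturbed solutions with one kernel -/

/-- **THE DIFFERENCE EQUATION, TWO SOURCES**: `(H_{V₁} + K)u₁ = f₁`, `(H_{V₂} + K)u₂ = f₂` with `u₁, u₂` bounded ⟹
`(H_{V₁} + K)(u₁ − u₂) = f₁ − f₂ − (V₁ − V₂)u₂` pointwise. [folklore] -/
theorem perturbed_difference_equation' (n : ℕ) (a : ℝ) {ε γ B₁ B₂ : ℝ} (hγ : 0 < γ) (V₁ V₂ : X d → ℝ) (K : X d → X d → ℝ)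
    (hK : ∀ p q, |K p q| ≤ ε * exp (-(γ * ∑ i, (((p i - q i).natAbs : ℕ) : ℝ)))) (u₁ u₂ f₁ f₂ : X d → ℝ)
    (hu₁B : ∀ p, |u₁ p| ≤ B₁) (hu₂B : ∀ p, |u₂ p| ≤ B₂)
    (hu₁ : ∀ p, ((n : ℝ) + 1) ^ 2 * ∑ μ', (2 * u₁ p - u₁ (p + e μ') - u₁ (p - e μ'))
      + a / ((n : ℝ) + 1) ^ d * ∑ q ∈ B n (blk n p), u₁ q + V₁ p * u₁ p + ∑' q : X d, K p q * u₁ q = f₁ p)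
    (hu₂ : ∀ p, ((n : ℝ) + 1) ^ 2 * ∑ μ', (2 * u₂ p - u₂ (p + e μ') - u₂ (p - e μ'))
      + a / ((n : ℝ) + 1) ^ d * ∑ q ∈ B n (blk n p), u₂ q + V₂ p * u₂ p + ∑' q : X d, K p q * u₂ q = f₂ p) (p : X d) :
    ((n : ℝ) + 1) ^ 2 * ∑ μ', (2 * (u₁ p - u₂ p) - (u₁ (p + e μ') - u₂ (p + e μ')) - (u₁ (p - e μ') - u₂ (p - e μ')))
      + a / ((n : ℝ) + 1) ^ d * ∑ q ∈ B n (blk n p), (u₁ q - u₂ q) + V₁ p * (u₁ p - u₂ p)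
      + ∑' q : X d, K p q * (u₁ q - u₂ q) = f₁ p - f₂ p - (V₁ p - V₂ p) * u₂ p := by
  have s1 : Summable (fun q : X d => K p q * u₁ q) := summable_kernel_row hγ K hK u₁ hu₁B p
  have s2 : Summable (fun q : X d => K p q * u₂ q) := summable_kernel_row hγ K hK u₂ hu₂B p
  have e1 : ∑' q : X d, K p q * (u₁ q - u₂ q) = ∑' q : X d, K p q * u₁ q - ∑' q : X d, K p q * u₂ q := by
    rw [← s1.tsum_sub s2]; exact tsum_congr fun q => by ring
  have e2 : ∑ q ∈ B n (blk n p), (u₁ q - u₂ q) = ∑ q ∈ B n (blk n p), u₁ q - ∑ q ∈ B n (blk n p), u₂ q :=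
    Finset.sum_sub_distrib _ _
  have e3 : ∑ μ' : Fin d, (2 * (u₁ p - u₂ p) - (u₁ (p + e μ') - u₂ (p + e μ')) - (u₁ (p - e μ') - u₂ (p - e μ')))
      = ∑ μ', (2 * u₁ p - u₁ (p + e μ') - u₁ (p - e μ')) - ∑ μ', (2 * u₂ p - u₂ (p + e μ') - u₂ (p - e μ')) := by
    rw [← Finset.sum_sub_distrib]; exact Finset.sum_congr rfl fun μ' _ => by ring
  rw [e1, e2, e3]
  linear_combination hu₁ p - hu₂ p

/-! ## §3. THE END: data that nearly agree on a set of blocks give solutions that agree there -/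

/-- **HEADLINE — NEAR DATA AGREEMENT ⟹ EXPONENTIAL AGREEMENT OF THE BOUNDED SOLUTIONS OF `H_V + K`**: `∃ C₀ C_P δ₀ > 0` from
`(d, a, λ, Λ)` such that for ALL `n`, potentials `V₁, V₂ : ℤ^d → [−λ, Λ]`, rates∕sizes under (216)'s two smallness conditions, ONE kernel
`|K(p,q)| ≤ εe^{−γ|p−q|₁}`, sources `|f₁|, |f₂| ≤ M`, BOUNDED solutions `(H_{V₁} + K)u₁ = f₁`, `(H_{V₂} + K)u₂ = f₂`, and a coarse set `A` on whose
blocks `V₁ = V₂` and `|f₁ − f₂| ≤ η`: `|u₁(p) − u₂(p)| ≤ C_∞η + C_∞(2 + 2(|λ| + Λ)C_∞)M·e^{−(μ∕2)D}` whenever `D ≤ |blk n p − c|₁` for all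
`c ∉ A`, `C_∞ = 2C_PK_{δ₀−μ}K_{μ∕2}` — §1 on the two pieces of the difference's source and (216)'s uniqueness. [folklore] -/
theorem zd_perturbed_data_agreement (hd : 3 ≤ d) (a : ℝ) (ha : 0 < a) {lam Lam : ℝ} (hlam : lam < min 2 a) (hLam : 0 ≤ Lam) :
    ∃ C₀ CP δ₀ : ℝ, 0 < C₀ ∧ 0 < CP ∧ 0 < δ₀ ∧ ∀ (n : ℕ) (V₁ V₂ : X d → ℝ), (∀ p, -lam ≤ V₁ p) → (∀ p, V₁ p ≤ Lam) →
      (∀ p, -lam ≤ V₂ p) → (∀ p, V₂ p ≤ Lam) →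
      ∀ (ε γ μ : ℝ), 0 ≤ ε → 0 < μ → μ < δ₀ → μ < γ →
      ε * (2 * (1 - exp (-γ))⁻¹) ^ d * C₀ ≤ 1 / 2 →
      (CP * (2 * (1 - exp (-(δ₀ - μ)))⁻¹) ^ d) * (ε * exp (μ * d) * (2 * (1 - exp (-(γ - μ)))⁻¹) ^ d) ≤ 1 / 2 →
      ∀ (K : X d → X d → ℝ), (∀ p q, |K p q| ≤ ε * exp (-(γ * ∑ i, (((p i - q i).natAbs : ℕ) : ℝ)))) →
      ∀ (f₁ f₂ : X d → ℝ) (M : ℝ), (∀ p, |f₁ p| ≤ M) → (∀ p, |f₂ p| ≤ M) →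
      ∀ (u₁ u₂ : X d → ℝ) (B₁ B₂ : ℝ), (∀ p, |u₁ p| ≤ B₁) → (∀ p, |u₂ p| ≤ B₂) →
      (∀ p, ((n : ℝ) + 1) ^ 2 * ∑ μ', (2 * u₁ p - u₁ (p + e μ') - u₁ (p - e μ'))
        + a / ((n : ℝ) + 1) ^ d * ∑ q ∈ B n (blk n p), u₁ q + V₁ p * u₁ p + ∑' q : X d, K p q * u₁ q = f₁ p) →
      (∀ p, ((n : ℝ) + 1) ^ 2 * ∑ μ', (2 * u₂ p - u₂ (p + e μ') - u₂ (p - e μ'))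
        + a / ((n : ℝ) + 1) ^ d * ∑ q ∈ B n (blk n p), u₂ q + V₂ p * u₂ p + ∑' q : X d, K p q * u₂ q = f₂ p) →
      ∀ (A : Set (X d)) (η : ℝ), 0 ≤ η → (∀ p, blk n p ∈ A → V₁ p = V₂ p ∧ |f₁ p - f₂ p| ≤ η) →
      ∀ (p : X d) (D : ℝ), (∀ c, c ∉ A → D ≤ ∑ i, (((blk n p i - c i).natAbs : ℕ) : ℝ)) →
        |u₁ p - u₂ p| ≤ (2 * (CP * (2 * (1 - exp (-(δ₀ - μ)))⁻¹) ^ d) * (2 * (1 - exp (-(μ / 2)))⁻¹) ^ d) * η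
          + (2 * (CP * (2 * (1 - exp (-(δ₀ - μ)))⁻¹) ^ d) * (2 * (1 - exp (-(μ / 2)))⁻¹) ^ d)
            * ((2 + 2 * (|lam| + Lam) * (2 * (CP * (2 * (1 - exp (-(δ₀ - μ)))⁻¹) ^ d) * (2 * (1 - exp (-(μ / 2)))⁻¹) ^ d)) * M)
            * exp (-(μ / 2 * D)) := by
  classical
  obtain ⟨C₀, CP, δ₀, hC₀, hCP, hδ₀, H1⟩ := zd_perturbed_block_superposition (d := d) hd a ha hlam hLam
  refine ⟨C₀, CP, δ₀, hC₀, hCP, hδ₀, ?_⟩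
  intro n V₁ V₂ hV₁ hV₁' hV₂ hV₂' ε γ μ hε hμ hμδ hμγ hs1 hs2 K hK f₁ f₂ M hf₁ hf₂ u₁ u₂ B₁ B₂ hu₁B hu₂B hu₁ hu₂ A η hη hA p D hD
  have hγ : 0 < γ := hμ.trans hμγ
  have hK0 : 0 < (2 * (1 - exp (-(δ₀ - μ)))⁻¹) ^ d := K_pos (d := d) (sub_pos.2 hμδ)
  have hKh : 0 < (2 * (1 - exp (-(μ / 2)))⁻¹) ^ d := K_pos (d := d) (by linarith)
  obtain ⟨Cs, hCs⟩ : ∃ Cs : ℝ, Cs = 2 * (CP * (2 * (1 - exp (-(δ₀ - μ)))⁻¹) ^ d) * (2 * (1 - exp (-(μ / 2)))⁻¹) ^ d := ⟨_, rfl⟩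
  have hCs0 : 0 < Cs := by rw [hCs]; positivity
  rw [← hCs]
  obtain ⟨hU₁, hS₁⟩ := H1 n V₁ hV₁ hV₁' ε γ μ hε hμ hμδ hμγ hs1 hs2 K hK
  obtain ⟨hU₂, hS₂⟩ := H1 n V₂ hV₂ hV₂' ε γ μ hε hμ hμδ hμγ hs1 hs2 K hK
  simp only [← hCs] at hS₁ hS₂
  have hM : 0 ≤ M := (abs_nonneg _).trans (hf₁ 0)
  -- `u₂` is §1's solution for `f₂` (`A = ∅`): `|u₂| ≤ C_∞M`
  obtain ⟨W₂, hW₂eq, hW₂B, -⟩ := hS₂ f₂ M hf₂ ∅ (fun q h => absurd h (Set.notMem_empty _))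
  have hu₂C : ∀ q, |u₂ q| ≤ Cs * M := fun q => by
    rw [hU₂ f₂ M hf₂ u₂ W₂ B₂ (Cs * M) hu₂B hW₂B hu₂ hW₂eq q]; exact hW₂B q
  have hVabs : ∀ (V : X d → ℝ), (∀ q, -lam ≤ V q) → (∀ q, V q ≤ Lam) → ∀ q, |V q| ≤ |lam| + Lam := fun V h1 h2 q =>
    abs_le.2 ⟨by linarith [h1 q, neg_abs_le lam, le_abs_self lam], by linarith [h2 q, abs_nonneg lam]⟩
  -- the source of the difference and its two pieces
  obtain ⟨g, hg⟩ : ∃ g : X d → ℝ, ∀ q, g q = f₁ q - f₂ q - (V₁ q - V₂ q) * u₂ q := ⟨_, fun _ => rfl⟩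
  have hgM : ∀ q, |g q| ≤ (2 + 2 * (|lam| + Lam) * Cs) * M := by
    intro q
    rw [hg]
    have e1 := hf₁ q; have e2 := hf₂ q; have e3 := hu₂C q
    have e4 := hVabs V₁ hV₁ hV₁' q; have e5 := hVabs V₂ hV₂ hV₂' q
    have e6 : |(V₁ q - V₂ q) * u₂ q| ≤ (|lam| + Lam + (|lam| + Lam)) * (Cs * M) := by
      rw [abs_mul]; exact mul_le_mul ((abs_sub _ _).trans (add_le_add e4 e5)) e3 (abs_nonneg _) (by positivity)
    calc |f₁ q - f₂ q - (V₁ q - V₂ q) * u₂ q| ≤ |f₁ q - f₂ q| + |(V₁ q - V₂ q) * u₂ q| := abs_sub _ _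
      _ ≤ (|f₁ q| + |f₂ q|) + |(V₁ q - V₂ q) * u₂ q| := by gcongr; exact abs_sub _ _
      _ ≤ (M + M) + (|lam| + Lam + (|lam| + Lam)) * (Cs * M) := by gcongr
      _ = (2 + 2 * (|lam| + Lam) * Cs) * M := by ring
  have hgA : ∀ q, blk n q ∈ A → |g q| ≤ η := fun q hq => by
    obtain ⟨h1, h2⟩ := hA q hq
    rw [hg, h1, sub_self, zero_mul, sub_zero]; exact h2
  obtain ⟨gA, hgAd⟩ : ∃ gA : X d → ℝ, ∀ q, gA q = if blk n q ∈ A then g q else 0 := ⟨_, fun _ => rfl⟩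
  obtain ⟨gF, hgFd⟩ : ∃ gF : X d → ℝ, ∀ q, gF q = if blk n q ∈ A then 0 else g q := ⟨_, fun _ => rfl⟩
  have hgAb : ∀ q, |gA q| ≤ η := fun q => by
    rw [hgAd]; split_ifs with h
    · exact hgA q h
    · rw [abs_zero]; exact hη
  have hgFb : ∀ q, |gF q| ≤ (2 + 2 * (|lam| + Lam) * Cs) * M := fun q => by
    rw [hgFd]; split_ifs
    · rw [abs_zero]; exact (abs_nonneg _).trans (hgM q)
    · exact hgM q
  have hgFA : ∀ q, blk n q ∈ A → gF q = 0 := fun q hq => by rw [hgFd, if_pos hq]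
  have hsplit : ∀ q, gA q + gF q = g q := fun q => by rw [hgAd, hgFd]; split_ifs <;> ring
  obtain ⟨WA, hWAeq, hWAB, -⟩ := hS₁ gA η hgAb ∅ (fun q h => absurd h (Set.notMem_empty _))
  obtain ⟨WF, hWFeq, hWFB, hWFfar⟩ := hS₁ gF _ hgFb A hgFA
  -- `W_A + W_far` solves the difference equation
  have hKA : ∀ q, Summable fun q' : X d => K q q' * WA q' := fun q => summable_kernel_row hγ K hK WA hWAB q
  have hKF : ∀ q, Summable fun q' : X d => K q q' * WF q' := fun q => summable_kernel_row hγ K hK WF hWFB q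
  have hWeq : ∀ q, ((n : ℝ) + 1) ^ 2 * ∑ μ', (2 * (WA q + WF q) - (WA (q + e μ') + WF (q + e μ')) - (WA (q - e μ') + WF (q - e μ')))
      + a / ((n : ℝ) + 1) ^ d * ∑ q' ∈ B n (blk n q), (WA q' + WF q') + V₁ q * (WA q + WF q)
      + ∑' q' : X d, K q q' * (WA q' + WF q') = g q := by
    intro q
    have e1 : ∑' q' : X d, K q q' * (WA q' + WF q') = ∑' q' : X d, K q q' * WA q' + ∑' q' : X d, K q q' * WF q' := by
      rw [← (hKA q).tsum_add (hKF q)]; exact tsum_congr fun q' => by ring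
    have e2 : ∑ q' ∈ B n (blk n q), (WA q' + WF q') = ∑ q' ∈ B n (blk n q), WA q' + ∑ q' ∈ B n (blk n q), WF q' :=
      Finset.sum_add_distrib
    have e3 : ∑ μ' : Fin d, (2 * (WA q + WF q) - (WA (q + e μ') + WF (q + e μ')) - (WA (q - e μ') + WF (q - e μ')))
        = ∑ μ', (2 * WA q - WA (q + e μ') - WA (q - e μ')) + ∑ μ', (2 * WF q - WF (q + e μ') - WF (q - e μ')) := by
      rw [← Finset.sum_add_distrib]; exact Finset.sum_congr rfl fun μ' _ => by ring
    rw [e1, e2, e3, ← hsplit q]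
    linear_combination hWAeq q + hWFeq q
  -- `u₁ − u₂` solves it too; uniqueness at `V₁`
  have hweq : ∀ q, ((n : ℝ) + 1) ^ 2 * ∑ μ', (2 * (u₁ q - u₂ q) - (u₁ (q + e μ') - u₂ (q + e μ')) - (u₁ (q - e μ') - u₂ (q - e μ')))
      + a / ((n : ℝ) + 1) ^ d * ∑ q' ∈ B n (blk n q), (u₁ q' - u₂ q') + V₁ q * (u₁ q - u₂ q)
      + ∑' q' : X d, K q q' * (u₁ q' - u₂ q') = g q := fun q => by
    rw [hg]; exact perturbed_difference_equation' n a hγ V₁ V₂ K hK u₁ u₂ f₁ f₂ hu₁B hu₂B hu₁ hu₂ q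
  have hwW := hU₁ g _ hgM (fun q => u₁ q - u₂ q) (fun q => WA q + WF q) (B₁ + B₂)
    (Cs * η + Cs * ((2 + 2 * (|lam| + Lam) * Cs) * M))
    (fun q => (abs_sub _ _).trans (add_le_add (hu₁B q) (hu₂B q)))
    (fun q => (abs_add_le _ _).trans (add_le_add (hWAB q) (hWFB q))) hweq hWeq p
  have hfarF := hWFfar p D hD
  calc |u₁ p - u₂ p| = |WA p + WF p| := by rw [hwW]
    _ ≤ |WA p| + |WF p| := abs_add_le _ _
    _ ≤ Cs * η + Cs * ((2 + 2 * (|lam| + Lam) * Cs) * M) * exp (-(μ / 2 * D)) := add_le_add (hWAB p) hfarF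

/-! ## §4. Toy -/

/-- Toy (`d = 3`, `a = 1`, `λ = 0`, `Λ = 1`): the constants of the agreement estimate exist. -/
example : ∃ C₀ CP δ₀ : ℝ, 0 < C₀ ∧ 0 < CP ∧ 0 < δ₀ :=
  let ⟨C₀, CP, δ₀, h1, h2, h3, _⟩ := zd_perturbed_data_agreement (d := 3) le_rfl 1 one_pos (lam := 0) (Lam := 1)
    (by rw [min_eq_right (by norm_num : (1 : ℝ) ≤ 2)]; norm_num) zero_le_one
  ⟨C₀, CP, δ₀, h1, h2, h3⟩

end Summit.QuantumFields.BalabanUV.T4Continuum.NE7b.SupZdPerturbedDataAgreement
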